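import Mathlib.Analysis.Calculus.ContDiff.Basic
import Mathlib.Analysis.Calculus.ContDiff.Operations
import Mathlib.Analysis.Calculus.IteratedDeriv.Lemmas
import Mathlib.Analysis.Normed.Operator.NormedSpace
import Literature.Analysis.FunctionSpaces.TorusSpaceTime
import HarnessLib

/-!
# Time derivatives of jointly smooth fields: slices, joint smoothness, compact bounds

Trunk: Sobolev (`Literature/Analysis/FunctionSpaces`). Bookkeeping for the estimates
`‖∂ₜᵏ v‖_{C^α}` of Bruè–De Lellis 2023, Thm. 4.1 (a) / (4.10) when the field is built from blocks
`V(t, z)` that are jointly `C^∞` in `(t, z) ∈ ℝ × E`: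

* `deriv_slice_eq_fderiv_uncurry` — `d/dt V(t, z) = D(uncurry V)(t, z)(1, 0)`;
* `ContDiff.uncurry_deriv_slice`, `ContDiff.uncurry_iteratedDeriv_slice` — `(t, z) ↦ ∂ₜᵏ V(t, z)`
  is again jointly `C^∞`;
* `norm_iteratedFDeriv_slice_le` — `‖D_zⁱ Ψ(t, ·)(z)‖ ≤ ‖Dⁱ Ψ(t, z)‖` for `Ψ ∈ Cⁿ(ℝ × E)`, hence
  bounds of the space derivatives of all slices on compact sets
  (`exists_forall_norm_iteratedFDeriv_slice_le`);
* on the torus, the `k`-fold one-sided time derivative `(Torus.timeDerivWithin S)^[k] u` is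
  `(t, x) ↦ iteratedDerivWithin k (u · x) S t` (`Torus.iterate_timeDerivWithin_apply`), so its
  slices are smooth when `u` is jointly smooth on `S × T^d`
  (`Torus.IsSmoothSpaceTimeOn.isSmooth_iteratedDerivWithin_slice`), and for globally smooth
  time dependence the one-sided derivative within `[a, b]` is the two-sided one
  (`iteratedDerivWithin_Icc_eq_iteratedDeriv_of_contDiff`).

## References

* E. Bruè, C. De Lellis, *Anomalous dissipation for the forced 3D Navier–Stokes equations*,
  Comm. Math. Phys. 400 (2023), Thm. 4.1 (a): `‖∂ₜᵏ v_n‖_{L^∞([0,1];C^α)} ≤ C(α,k) 5^{(α-1)n}`.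
-/

noncomputable section

open Set Filter Function
open scoped Topology ContDiff

namespace Literature.Analysis.FunctionSpaces

section Slices

variable {E : Type*} [NormedAddCommGroup E] [NormedSpace ℝ E]
variable {X : Type*} [NormedAddCommGroup X] [NormedSpace ℝ X]

/-- The time derivative of a slice is the Fréchet derivative of the joint map in the direction
`(1, 0)`: `d/dt V(t, z) = D(uncurry V)(t, z)(1, 0)`. [folklore] -/
theorem deriv_slice_eq_fderiv_uncurry {V : ℝ → E → X} {t : ℝ} {z : E}
    (h : DifferentiableAt ℝ (uncurry V) (t, z)) :
    deriv (fun s => V s z) t = fderiv ℝ (uncurry V) (t, z) (1, 0) := by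
  have hc : HasFDerivAt (uncurry V ∘ fun s : ℝ => (s, z))
      ((fderiv ℝ (uncurry V) (t, z)).comp (ContinuousLinearMap.inl ℝ ℝ E)) t :=
    h.hasFDerivAt.comp t (hasFDerivAt_prodMk_left (𝕜 := ℝ) t z)
  have hd : HasDerivAt (uncurry V ∘ fun s : ℝ => (s, z)) (fderiv ℝ (uncurry V) (t, z) (1, 0)) t := by
    have := hc.hasDerivAt
    simpa using this
  exact hd.deriv

/-- **Time derivatives of jointly smooth fields are jointly smooth**: if `(t, z) ↦ V(t, z)` is
`C^∞` then so is `(t, z) ↦ d/dt V(t, z)`. [folklore] -/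
theorem ContDiff.uncurry_deriv_slice {V : ℝ → E → X} (hV : ContDiff ℝ ∞ (uncurry V)) :
    ContDiff ℝ ∞ (uncurry fun t z => deriv (fun s => V s z) t) := by
  have h1 : ContDiff ℝ ∞ fun p : ℝ × E => fderiv ℝ (uncurry V) p (1, 0) :=
    (hV.fderiv_right (m := ∞) (by simp)).clm_apply contDiff_const
  have heq : (uncurry fun t z => deriv (fun s => V s z) t) =
      fun p : ℝ × E => fderiv ℝ (uncurry V) p (1, 0) := by
    funext p
    obtain ⟨t, z⟩ := p
    exact deriv_slice_eq_fderiv_uncurry ((hV.differentiable (by simp)) (t, z))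
  rwa [heq]

/-- Iterated time derivatives of jointly smooth fields are jointly smooth:
`(t, z) ↦ ∂ₜᵏ V(t, z)` is `C^∞`. [folklore] -/
theorem ContDiff.uncurry_iteratedDeriv_slice {V : ℝ → E → X} (hV : ContDiff ℝ ∞ (uncurry V))
    (k : ℕ) : ContDiff ℝ ∞ (uncurry fun t z => iteratedDeriv k (fun s => V s z) t) := by
  induction k with
  | zero => simpa using hV
  | succ k ih =>
      have h := ContDiff.uncurry_deriv_slice (V := fun t z => iteratedDeriv k (fun s => V s z) t) ih
      have heq : (uncurry fun t z => iteratedDeriv (k + 1) (fun s => V s z) t) =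
          uncurry fun t z => deriv (fun s => iteratedDeriv k (fun s' => V s' z) s) t := by
        funext p
        obtain ⟨t, z⟩ := p
        simp only [uncurry_apply_pair, iteratedDeriv_succ]
      rwa [heq]

/-- A slice `z ↦ Ψ(t, z)` of a `Cⁿ` map on `ℝ × E` is `Cⁿ`. [folklore] -/
theorem ContDiff.slice_right {Ψ : ℝ × E → X} {n : WithTop ℕ∞} (hΨ : ContDiff ℝ n Ψ) (t : ℝ) :
    ContDiff ℝ n fun z => Ψ (t, z) :=
  hΨ.comp (contDiff_prodMk_right t)

/-- **Space derivatives of slices**: for `Ψ ∈ Cⁿ(ℝ × E)` and `i ≤ n`,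
`D_zⁱ (Ψ(t, ·))(z) = DⁱΨ(t, z) ∘ (inr)^{⊗ i}`, so `‖D_zⁱ (Ψ(t, ·))(z)‖ ≤ ‖DⁱΨ(t, z)‖`
(`‖inr‖ ≤ 1`). [folklore] -/
theorem norm_iteratedFDeriv_slice_le {Ψ : ℝ × E → X} {n : ℕ} (hΨ : ContDiff ℝ n Ψ) (t : ℝ)
    {i : ℕ} (hi : i ≤ n) (z : E) :
    ‖iteratedFDeriv ℝ i (fun z => Ψ (t, z)) z‖ ≤ ‖iteratedFDeriv ℝ i Ψ (t, z)‖ := by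
  set Ψ' : ℝ × E → X := fun q => Ψ (q + (t, 0)) with hΨ'
  have hΨ'c : ContDiff ℝ n Ψ' := hΨ.comp (contDiff_id.add contDiff_const)
  have hcomp : (fun z => Ψ (t, z)) = Ψ' ∘ ContinuousLinearMap.inr ℝ ℝ E := by
    funext z; simp [hΨ']
  rw [hcomp, (ContinuousLinearMap.inr ℝ ℝ E).iteratedFDeriv_comp_right hΨ'c z
    (by exact_mod_cast hi)]
  have htr : iteratedFDeriv ℝ i Ψ' (ContinuousLinearMap.inr ℝ ℝ E z) = iteratedFDeriv ℝ i Ψ (t, z) := by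
    rw [hΨ', iteratedFDeriv_comp_add_right]
    simp
  refine (ContinuousMultilinearMap.norm_compContinuousLinearMap_le _ _).trans ?_
  rw [htr, Finset.prod_const, Finset.card_univ, Fintype.card_fin]
  refine mul_le_of_le_one_right (norm_nonneg _) ?_
  exact pow_le_one₀ (norm_nonneg _) (ContinuousLinearMap.norm_inr_le_one ℝ ℝ E)

/-- **Uniform bounds of space derivatives of slices on compacts**: for `Ψ ∈ Cⁿ(ℝ × E)`, a
compact `K ⊆ ℝ × E` and `i ≤ n` there is `M ≥ 0` with `‖D_zⁱ(Ψ(t, ·))(z)‖ ≤ M` for all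
`(t, z) ∈ K` (`DⁱΨ` is continuous). [folklore] -/
theorem exists_forall_norm_iteratedFDeriv_slice_le {Ψ : ℝ × E → X} {n : ℕ} (hΨ : ContDiff ℝ n Ψ)
    {K : Set (ℝ × E)} (hK : IsCompact K) {i : ℕ} (hi : i ≤ n) :
    ∃ M : ℝ, 0 ≤ M ∧ ∀ p ∈ K, ‖iteratedFDeriv ℝ i (fun z => Ψ (p.1, z)) p.2‖ ≤ M := by
  obtain ⟨M, hM⟩ := hK.exists_bound_of_continuousOn
    ((hΨ.continuous_iteratedFDeriv (by exact_mod_cast hi)).continuousOn)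
  refine ⟨max M 0, le_max_right _ _, fun p hp => ?_⟩
  exact ((norm_iteratedFDeriv_slice_le hΨ p.1 hi p.2).trans (hM p hp)).trans (le_max_left _ _)

/-- Within a closed interval, the iterated one-sided derivative of a globally `Cᵏ` function is
the ordinary iterated derivative (`[a, b]` has unique derivatives for `a < b`). [folklore] -/
theorem iteratedDerivWithin_Icc_eq_iteratedDeriv_of_contDiff {f : ℝ → X} {k : ℕ} {a b : ℝ}
    (hab : a < b) (hf : ContDiff ℝ k f) {t : ℝ} (ht : t ∈ Icc a b) :
    iteratedDerivWithin k f (Icc a b) t = iteratedDeriv k f t :=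
  iteratedDerivWithin_eq_iteratedDeriv (uniqueDiffOn_Icc hab) hf.contDiffAt ht

end Slices

/-! ## Iterated one-sided time derivatives of fields on the torus -/

namespace Torus

variable {d : Type*} {F : Type*} [NormedAddCommGroup F] [NormedSpace ℝ F]

/-- The `k`-fold one-sided time derivative is the iterated derivative within the time set of the
time slices: `((timeDerivWithin S)^[k] u) t x = iteratedDerivWithin k (u · x) S t`. [folklore] -/
theorem iterate_timeDerivWithin_apply (S : Set ℝ) (k : ℕ) (u : ℝ → UnitAddTorus d → F) (t : ℝ)
    (x : UnitAddTorus d) :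
    ((Torus.timeDerivWithin S)^[k] u) t x = iteratedDerivWithin k (fun s => u s x) S t := by
  rw [iteratedDerivWithin_eq_iterate]
  induction k generalizing u with
  | zero => rfl
  | succ k ih =>
      rw [Function.iterate_succ_apply, Function.iterate_succ_apply, ih]
      rfl

variable [Fintype d]

/-- Iterated one-sided time derivatives of a jointly smooth field are jointly smooth (on time
sets of unique differentiability). [folklore] -/
theorem IsSmoothSpaceTimeOn.iterate_timeDerivWithin {S : Set ℝ} {u : ℝ → UnitAddTorus d → F}
    (hu : IsSmoothSpaceTimeOn S u) (hS : UniqueDiffOn ℝ S) (k : ℕ) :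
    IsSmoothSpaceTimeOn S ((Torus.timeDerivWithin S)^[k] u) := by
  induction k with
  | zero => exact hu
  | succ k ih =>
      rw [Function.iterate_succ_apply']
      exact ih.timeDerivWithin hS

/-- **Slices of iterated time derivatives are smooth**: if `u` is jointly smooth on `S × T^d`
(`S` of unique differentiability, e.g. `[a, b]`), then for `t ∈ S` the field
`x ↦ ∂ₜᵏ u(t, x) := iteratedDerivWithin k (u · x) S t` is smooth on `T^d`. [folklore] -/
theorem IsSmoothSpaceTimeOn.isSmooth_iteratedDerivWithin_slice {S : Set ℝ}
    {u : ℝ → UnitAddTorus d → F} (hu : IsSmoothSpaceTimeOn S u) (hS : UniqueDiffOn ℝ S) (k : ℕ)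
    {t : ℝ} (ht : t ∈ S) : IsSmooth fun x => iteratedDerivWithin k (fun s => u s x) S t := by
  have h := (hu.iterate_timeDerivWithin hS k).isSmooth_slice ht
  have heq : ((Torus.timeDerivWithin S)^[k] u) t = fun x => iteratedDerivWithin k (fun s => u s x) S t :=
    funext fun x => iterate_timeDerivWithin_apply S k u t x
  rwa [heq] at h

end Torus

end Literature.Analysis.FunctionSpaces
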